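import Summits.Ventures.PercRepro.S2RowFifteenOpen
import Summits.Ventures.PercRepro.S2FifteenEight
import Summits.Ventures.PercRepro.S2FifteenNine

/-!
# PercRepro — S2: THE `p = 15` ROW — THE EIGHT OPEN CELLS AS ONE HYPOTHESIS (p7, gen 11; sub-claim S2)

With `(15, 8)` (S2FifteenEight), `(15, 9)` (S2FifteenNine) and `(15, 15)` (S2FifteenFifteen) tree theorems, the «16» assembly needs only the
EIGHT cells `(15, 6)`, `(15, 7)`, `(15, 10)`, `(15, 11)`, `(15, 12)`, `(15, 13)`, `(15, 14)`, `(15, 16)`: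
**`c025_five_large_sharp16_of_eight_cells`** — C-025 at level `5` for every `p ≥ 16` from `RLS M 15 5` on the `e`-free cores of rank `15`
and corank `d ∈ {6, 7, 10, 11, 12, 13, 14, 16}`. Those eight are priced OPEN (S2 v33 §R3⁗(r)(5): `(15, 6)` 1.22 and `(15, 7)` 1.06 in the
spread case, `(15, 10)` 1.004 / 1.034, `(15, 11)` 1.09, `(15, 12)` 1.19, `(15, 13)` / `(15, 16)` through their coloop cases 1.00 / 1.08 and 1.12,
`(15, 14)` 1.06 — with every lever the cell has, the flat count included). Nothing here asserts a window move. Axioms: standard.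
-/

open scoped Matroid

namespace PercRepro

namespace ThmN

variable {α : Type}

/-- **THEOREM C₅ AT `16` MODULO THE EIGHT OPEN CELLS** `(15, 6)`, `(15, 7)`, `(15, 10 … 14)`, `(15, 16)`. -/
theorem c025_five_large_sharp16_of_eight_cells
    (height : ∀ (M : Matroid α) [M.Finite] (d : ℕ), 6 ≤ d → d ≤ 16 → d ≠ 8 → d ≠ 9 → d ≠ 15 →
      M.eRank = ((15 : ℕ) : ℕ∞) → M.E.ncard = 15 + d →
      (∀ e ∈ M.E, ∃ A ⊆ M.E \ {e}, e ∉ M.closure A ∧ e ∉ M.closure ((M.E \ {e}) \ A)) → RLS M 15 5)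
    (M : Matroid α) [M.Finite] (p : ℕ) (hp : 16 ≤ p) : RLS M p 5 := by
  refine c025_five_large_sharp16_of_ten_cells ?_ M p hp
  intro M _ d hd6 hd16 hd15 hR hn hfree
  by_cases h8 : d = 8
  · subst h8
    exact c025_core_five_fifteen_eight M hR hn hfree
  by_cases h9 : d = 9
  · subst h9
    exact c025_core_five_fifteen_nine M hR hn hfree
  exact height M d hd6 hd16 h8 h9 hd15 hR hn hfree

end ThmN

end PercRepro
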